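import Literature.AnabelianGeometry.EtaleTheta.LogDivisorModelRootLawNoGo
import Literature.AnabelianGeometry.EtaleTheta.Discharge.Sec4NonVacuityTowerLaws

/-!
# [EtTh] Def. 3.1 (ii) ERRATUM E2 at the level of the Def. 3.3 (iii) DATA: the covering root law of `B₀` over `D₀`,
# and the §4 binder `BaseRootLaw` (A10) DERIVED from it along the base functor

S. Mochizuki, *The étale theta function …*, Publ. RIMS **45** (2009) [MochizukiEtTh2009], §3 Def. 3.1 (ii) p.70 with
ERRATUM E2 = [IUTchI] Rmk. 3.2.4 (i)(a)/(iv)(A) («tempered-meromorphic»: for every `N ∈ ℕ_{≥1}`, `f` admits an `N`-th root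
over some tempered covering), Def. 3.3 (iii) pp.73–74 (`B₀ : D₀ → Mon`), Def. 3.6 (i)(ii) pp.76–77, Prop. 4.2 (iii) proof
p.89 [cite: MochizukiEtTh2009, Def 3.3 (iii) p.73].  abc-iut cell, layer L2; seat abc-iut-L2-t3 (gen 5), owner of
`DivisorMonoids` / `TemperedFrobenioid`; census A10 lineage (`TemperedFrobenioid.BaseRootLaw` p443354; no-go in the v1 model
class p447056, label F-L2t3g5-1; FOUNDATIONS row «LogDivisorModel v2», abc-iut-L2-lead R342/R387).  CLASS (c): ONE
`Prop`-valued one-field structure on the EXISTING `DivisorMonoids` + proof-only theorems; nothing landed is edited.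

* §1 **`DivisorMonoids.RootLaw dm`** — E2 (a) read on the Def. 3.3 (iii) data themselves: every `b ∈ B₀(Y)` has, for
  every `N ≥ 1`, an `N`-th root in `B₀(Y')` over SOME covering `Y' → Y` of `D₀` (pull-back `B₀(Y) → B₀(Y')`).  This is
  the form in which the clause is a property of `(D₀, B₀)` alone — satisfiable when `D₀` contains the Kummer-type
  coverings and `B₀` reads each covering at its own `Δ^fil`-closure (the v2 datum `DivisorMonoids.ofTower`, staged),
  and (§3) collapsing to `B₀ = 1` in the v1 class.
* §2 **`TemperedFrobenioid.baseRootLaw_of_rootLaw`** (`ofRlfZWeak` and `ofRlfZ`, monoid type `ℤ`, `B₀^ℤ = B₀`): the §4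
  binder A10 `tf.BaseRootLaw IG` FOLLOWS from `dm.RootLaw` and a LIFTING property of the base functor `tf.base : D ⥤ D₀`
  («every covering of `Y_X` in `D₀` is dominated by `Y_{X'}` for an `IG`-cover `X' ⟶ X` of `D`» — at print's `D = D₀[𝒟]`
  with `IG` = Galois this is the existence of Galois closures); so G-w4d044-3's `hR₀` is DISCHARGED modulo
  {`RootLaw` of the data, the lift}.
* §3 `DivisorMonoids.rootLaw_ofGaloisActionConnected_iff` — on abc-iut-w6-d058's connected data the new predicate IS
  the model-level `GaloisAction.RootLaw` of p447056, hence (`bZero_eq_one_of_rootLaw_ofGaloisActionConnected`) forces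
  `B₀ = 1` there (F-L2t3g5-1 restated at the Def. 3.3 (iii) level; NV: it FAILS at the Tate tower's data,
  `TateTower.not_rootLaw_divisorMonoids`) — and §4 NV positive: it HOLDS at the Kummer toy tower
  (`ToyTower.rootLaw_divisorMonoids`, abc-iut-w4-d044 / w6-d037's `ToyTower.baseRootLaw` re-keyed).
HONEST FRAMING: binder + implications; no instance of `RootLaw` with non-trivial `B₀` exists in the tree until the v2
tower model lands; typed ≠ proved; nothing here bears on the disputed [IUTchIII] Cor. 3.12.
-/

noncomputable section

namespace Literature.AnabelianGeometry.EtaleTheta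

open CategoryTheory Opposite Function Literature.AlgebraicGeometry.Frobenioids

universe u₀ v₀ u v w

/-! ### §1 The covering root law of `B₀` over `D₀` -/

namespace DivisorMonoids

variable {D₀ : Type u₀} [Category.{v₀} D₀]

/-- **E2 (a) on the Def. 3.3 (iii) data** (class (c) binder): for every `N ≥ 1`, every `Y ∈ D₀` and every
`b ∈ B₀(Y)` there are a covering `f : Y' ⟶ Y` in `D₀` and `r ∈ B₀(Y')` with `r^N = B₀(f)(b)` — «`f` admits an `N`-th
root over some tempered covering» ([IUTchI] Rmk. 3.2.4 (i)(a)) read for the functor `B₀ : D₀ → Mon`.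
[cite: MochizukiEtTh2009, Def 3.3 (iii) p.73] -/
@[mk_iff] structure RootLaw (dm : DivisorMonoids.{u₀, v₀, w} D₀) : Prop where
  /-- roots over coverings of `D₀` -/
  exists_root : ∀ (N : ℕ+) (Y : D₀) (b : dm.B₀.obj (op Y)),
    ∃ (Y' : D₀) (f : Y' ⟶ Y) (r : dm.B₀.obj (op Y')), r ^ (N : ℕ) = (dm.B₀.map f.op).hom b

/-- Roots pull back: a root of `b` over `Y'` gives a root of `b` over any `Y'' → Y'`.
[cite: MochizukiEtTh2009, Def 3.3 (iii) p.73] -/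
theorem RootLaw.exists_root_over (dm : DivisorMonoids.{u₀, v₀, w} D₀) {N : ℕ} {Y Y' Y'' : D₀} (f : Y' ⟶ Y)
    (g : Y'' ⟶ Y') (b : dm.B₀.obj (op Y)) (r : dm.B₀.obj (op Y')) (hr : r ^ N = (dm.B₀.map f.op).hom b) :
    ((dm.B₀.map g.op).hom r) ^ N = (dm.B₀.map (g ≫ f).op).hom b := by
  rw [← map_pow, hr, op_comp, dm.B₀.map_comp]
  rfl

end DivisorMonoids

/-! ### §2 The §4 binder `BaseRootLaw` from the root law of the data and a lift of coverings along the base -/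

namespace TemperedFrobenioid

section Weak

variable {D₀ : Type u} [Category.{v} D₀] {dm : DivisorMonoids.{u, v, w} D₀}
  {hpf : ∀ Y : D₀ᵒᵖ, IsPerfFactorialCof (dm.Φ₀.obj Y)}
  {D : Type u₀} [Category.{v₀} D] {VD : FrdICatStub.{u₀, v₀, w} D}
  (tf : TemperedFrobenioid (RealifiedDivisorMonoids.ofRlfZWeak dm hpf) D VD)

/-- **A10 from E2 (a) on the data** (monoid type `ℤ`, weak vocabulary, `B₀^ℤ = B₀`): if the Def. 3.3 (iii) data satisfy
the covering root law and every covering of `Y_X` (`X` an `IG`-object) in `D₀` is DOMINATED by the image of an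
`IG`-cover `X' ⟶ X` of `D` (`hLift`: at print's `D = D₀[𝒟]`, `IG` = Galois, this is «pass to a Galois closure»), then
`tf.BaseRootLaw IG` — the binder `hR₀` of Prop. 4.2 (iii) (G-w4d044-3) — HOLDS. [cite: MochizukiEtTh2009, Prop 4.2 (iii) p.89] -/
theorem baseRootLaw_of_rootLaw (hR : dm.RootLaw) (IG : D → Prop)
    (hLift : ∀ (X : D), IG X → ∀ (Y' : D₀) (f : Y' ⟶ tf.base.obj X),
      ∃ (X' : D) (_ : IG X') (c : X' ⟶ X) (g : tf.base.obj X' ⟶ Y'), g ≫ f = tf.base.map c) :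
    tf.BaseRootLaw IG := by
  intro N X hX b
  obtain ⟨Y', f, r, hr⟩ := hR.exists_root N (tf.base.obj X) b
  obtain ⟨X', hX', c, g, hgf⟩ := hLift X hX Y' f
  refine ⟨X', hX', c, (dm.B₀.map g.op).hom r, ?_⟩
  have h := DivisorMonoids.RootLaw.exists_root_over dm f g b r hr
  rw [hgf] at h
  exact h

end Weak

section Strong

variable {D₀ : Type u} [Category.{v} D₀] {dm : DivisorMonoids.{u, v, w} D₀}
  {hpf : ∀ Y : D₀ᵒᵖ, IsPerfFactorial (dm.Φ₀.obj Y)}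
  {D : Type u₀} [Category.{v₀} D] {VD : FrdICatStub.{u₀, v₀, w} D}
  (tf : TemperedFrobenioid (RealifiedDivisorMonoids.ofRlfZ dm hpf) D VD)

/-- `ofRlfZ` (printed-vocabulary) twin of `baseRootLaw_of_rootLaw`. [cite: MochizukiEtTh2009, Prop 4.2 (iii) p.89] -/
theorem baseRootLaw_of_rootLaw_ofRlfZ (hR : dm.RootLaw) (IG : D → Prop)
    (hLift : ∀ (X : D), IG X → ∀ (Y' : D₀) (f : Y' ⟶ tf.base.obj X),
      ∃ (X' : D) (_ : IG X') (c : X' ⟶ X) (g : tf.base.obj X' ⟶ Y'), g ≫ f = tf.base.map c) :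
    tf.BaseRootLaw IG := by
  intro N X hX b
  obtain ⟨Y', f, r, hr⟩ := hR.exists_root N (tf.base.obj X) b
  obtain ⟨X', hX', c, g, hgf⟩ := hLift X hX Y' f
  refine ⟨X', hX', c, (dm.B₀.map g.op).hom r, ?_⟩
  have h := DivisorMonoids.RootLaw.exists_root_over dm f g b r hr
  rw [hgf] at h
  exact h

end Strong

end TemperedFrobenioid

/-! ### §3 On the v1 connected data the predicate is the model-level root law (hence collapses) -/

namespace DivisorMonoids

open LogDivisorModel.GaloisAction

variable {Z : LogDivisorModel.{u}} {G : Type u} [Group G] (A : Z.GaloisAction G) (hZ : Z.CuspLaws)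

/-- On abc-iut-w6-d058's Def. 3.3 (iii) data of the connected coverings dominated by `Z^log_∞`, `RootLaw` IS the
model-level `GaloisAction.RootLaw` (p447056). [cite: MochizukiEtTh2009, Def 3.3 (iii) p.73] -/
theorem rootLaw_ofGaloisActionConnected_iff : (ofGaloisActionConnected A hZ).RootLaw ↔ A.RootLaw := by
  constructor
  · intro h
    refine ⟨fun N S hS b => ?_⟩
    obtain ⟨Y', f, r, hr⟩ := h.exists_root N ⟨S, hS⟩ b
    exact ⟨Y'.obj, Y'.property, f.hom, r, hr⟩
  · intro h
    refine ⟨fun N Y b => ?_⟩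
    obtain ⟨S', hS', f, r, hr⟩ := h.exists_root N Y.obj Y.property b
    exact ⟨⟨S', hS'⟩, ⟨f⟩, r, hr⟩

/-- **Hence, in the v1 class, `RootLaw` forces `B₀ = 1`** (F-L2t3g5-1 at the Def. 3.3 (iii) level: Prop. 3.2 (iii) on the
single value group `Mero(Z_∞)`). [cite: MochizukiEtTh2009, Prop 3.2 (iii) p.70] -/
theorem bZero_eq_one_of_rootLaw_ofGaloisActionConnected (h : (ofGaloisActionConnected A hZ).RootLaw)
    (Y : (isConnectedGSet (G := G)).FullSubcategory) (b : (ofGaloisActionConnected A hZ).B₀.obj (op Y)) : b = 1 :=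
  A.bZero_eq_one_of_rootLaw ((rootLaw_ofGaloisActionConnected_iff A hZ).1 h) Y.property b

end DivisorMonoids

/-- NV: at abc-iut-w6-d058's Tate tower (p444705) the Def. 3.3 (iii)-level root law FAILS (its `B₀` is non-trivial:
the Tate coordinate `U`) — consistent with `TateTower.not_rootLaw`. [cite: MochizukiEtTh2009, Def 3.1 (ii) p.70] -/
theorem LogDivisorModel.TateTower.not_rootLaw_divisorMonoids :
    ¬ (DivisorMonoids.ofGaloisActionConnected LogDivisorModel.TateTower.action LogDivisorModel.TateTower.cuspLaws).RootLaw :=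
  fun h => LogDivisorModel.TateTower.not_rootLaw
    ((DivisorMonoids.rootLaw_ofGaloisActionConnected_iff _ _).1 h)

/-- **NV, positive**: at abc-iut-w4-d044 / w6-d037's Kummer toy TOWER (`ToyTower`: `D₀ = Base` = the covers
`X_{N·M} → X_M`, `B₀ = ℂˣ × t^ℤ` acquiring roots upstairs, `Sec4NonVacuityTowerLaws` p43xxxx) the data-level root law
HOLDS — `ToyTower.baseRootLaw` re-keyed (their base functor is `𝟭`, `B₀^ℤ = B₀`).  So `DivisorMonoids.RootLaw` is
consistent with a non-trivial `B₀` exactly when `D₀` carries the root-producing covers — the v2 situation.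
[cite: MochizukiEtTh2009, Prop 4.2 (iii) p.89] -/
theorem ToyTower.rootLaw_divisorMonoids : ToyTower.divisorMonoids.RootLaw :=
  ⟨fun N Y b => by
    obtain ⟨Y', -, c, b', hb'⟩ := ToyTower.baseRootLaw N Y trivial b
    exact ⟨Y', c, b', hb'⟩⟩

end Literature.AnabelianGeometry.EtaleTheta

end
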